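import Summits.ABC.IUTFork.Cor312ProvKRamified
import Summits.ABC.IUTFork.Repair.CandInternal2RealLabelsLicenceGenuineK
import HarnessLib

/-!
# R-H ROUND 1 (D-0079 «local-height condition I06⋆», D-0107), candidate row 12 `v-divides-l-stratum`: the STRATUM `{bad v : v ∣ 2l}`
# is EMPTY at every genuine `K`-level datum `Cor312Prov.pilotDataOfK D K` — every `H⋆` supported on it holds VACUOUSLY (verdict UNTESTED: scope empty)

Bookkeeping file of the abc-iut cell, rung LADDER-ABC:A2.RESCUE.H (plan/rescue/R-H/START-HERE.md v1.2, RH-CANDIDATES.tsv v1 row 12; seat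
abc-iut-rh-typ-12 = TYPER of pair 12). TAKES NO SIDE on [IUTchIII] Cor. 3.12 or on any author; the candidate is a HYPOTHESIS SHAPE (claim-tagged
`def … : Prop`), never a Literature fact; typed ≠ proved; instantiated ≠ endorsed. ONE bookkeeping definition (`OnStratum`, the class of
row-12 candidates) and its I06⋆ instance; everything else PROOF-ONLY, consumed BY NAME.

ROW 12 (verbatim, RH-CANDIDATES.tsv v1 f7773e15cd7f6906, writer abc-iut-rh-lead g0): informal statement «any H* whose support is the stratum of
bad places v with v | l or v | 2 (deeply-ramified-at-l pricing)»; stratum/scope «stratum {bad v : v | 2l}»; k1 recipe «count the rows of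
I06STAR-COLUMNS with p = l or p = 2 among BAD places of GENUINE data»; lead prediction «EMPTY at genuine initial Theta-data: [IUTchI] Def 3.1 (b)
bad places have ODD residue characteristic, (c) l is prime to the residue characteristics of V_bad^mod … => no bad v divides 2l».

WHAT IS TYPED / PROVED (namespace `Summit.ABC.IUTFork.Repair.RH.VDividesLStratum`), at the genuine `K`-level pilot datum `pilotDataOfK D K` of
an arbitrary collection of initial Θ-data `D : InitialThetaData F K Fbar E l Pb` ([IUTchI] Def. 3.1), bad places = `(pilotDataOfK D K).S`,
packets indexed by rational primes `pp`, places `w` in the fibre over `pp`: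
* `OnStratum D C` — THE CLASS OF ROW-12 CANDIDATES: an arbitrary per-cell demand `C pp i w` (label `j = i+1 ∈ 𝔽_l^⋇`) made ONLY at bad places
  `w ∣ p` with `p ∣ 2l`; `OnStratumI06 D tq` — its I06⋆ instance (abc-iut-rp-d2's REAL I06⋆ cell `t_{q,w} ∈ t_{q,w}^{j²}·ℐ_{K_w}` for a q-idele
  `tq`, demanded on the stratum only).
* **`not_dvd_two_mul_l_of_placeOf_mem_S`** — at a bad place `w ∣ p` of the genuine datum, `¬ p ∣ 2l`: abc-iut-w5-d054's
  `Cor312Prov.ne_two_and_ne_l_of_placeOf_mem_S_pilotDataOfK` (`p ≠ 2 ∧ p ≠ l`, = L5-t2's fields `InitialThetaData.VbadMod_odd` (Def. 3.1 (b))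
  and `InitialThetaData.l_ne_residueChar` (Def. 3.1 (c)) read at `K`) plus primality of `p` and `l` (`InitialThetaData.l_prime`).
* **`stratum_empty`** — `¬ ∃ pp w, placeOf w ∈ S ∧ p ∣ 2l`: the scope of row 12 is EMPTY at every genuine datum.
* **`onStratum_holds`** — `OnStratum D C` holds for EVERY demand `C` (vacuity); `onStratum_iff_true`; `onStratumI06_holds`.
* **`imp_iff_of_onStratum`** — for every proposition `X`, `(OnStratum D C → X) ↔ X`: a k2 glue «H⋆ → S_H-window» from a row-12 candidate is
  a proof of the S_H-window clause OUTRIGHT; instantiated at the window bed of record: **`licence_settingPrVolSharp_imp_iff`** —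
  `(OnStratum D C → Licence (settingPrVolSharp (pilotDataOfK D K) …)) ↔ Licence (settingPrVolSharp (pilotDataOfK D K) …)`.
* `not_exists_supported` — dually, a candidate that POSITS a bad cell on the stratum (`∃` form) is FALSE at every genuine datum.
* §3 the k1 count in the column vocabulary of I06STAR-COLUMNS (`p`, `l`): `dvd_two_mul_iff_of_table` — among the table's packets (`p = 7`,
  `l ∈ {5, 7, 11, 13, 17, …}`; DH rows `(11, 13)`, `(67, 7)`) `p ∣ 2l` iff `(p, l) = (7, 7)`, the calibration strip flagged «l not
  HEX-admissible» — inadmissible precisely because `p = l` contradicts Def. 3.1 (c); 0 of the 256 G-HEX rows / 4 concrete data / 2 DH data.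

VERDICT WORD for ROUND1.tsv (pre-registered by the lead, confirmed in kernel): **UNTESTED (scope EMPTY at genuine data)** — a stratum-supported
`H⋆` is vacuously true at every genuine datum and supplies no licence cell anywhere (k2 door = the target itself); this closes the «v ∣ l / v ∣ 2
pricing» family for R-H. (The strata `v ∣ 2`, `v ∣ l` remain relevant to the GOOD-place log-volume terms of [IUTchIV] Thm. 1.10 — R-W/C
business, not the I06⋆ column; START-HERE §6 ruling.) [cite: Mochizuki2012, IUTchI Def. 3.1 (b),(c) pp. 61–62; Ex. 3.2 (iv) p. 71]
[claim: Mochizuki2012, status: disputed] for every IUT locution. Axioms: standard.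
-/

noncomputable section

open Set Function NumberField IsDedekindDomain
open scoped Pointwise

namespace Summit.ABC.IUTFork.Repair.RH.VDividesLStratum

open Literature.AnabelianGeometry.AbsoluteAnabelian Literature.IUT.LogThetaLattice Literature.IUT.LogVolume
  Literature.IUT.HodgeTheaters Literature.NumberTheory.NumberFields
open Summit.ABC.IUTFork.Thm311 Summit.ABC.IUTFork.Thm311.Real Summit.ABC.IUTFork.Cor312 Summit.ABC.IUTFork.Cor312Vol
  Summit.ABC.IUTFork.Cor312Prov

variable {F K Fbar : Type} [Field F] [NumberField F] [Field K] [NumberField K] [Algebra F K] [Field Fbar]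
  [Algebra F Fbar] [Algebra K Fbar] {E : WeierstrassCurve F} [E.IsElliptic] {l : ℕ} {Pb : BadPlacePredicates K}
  (D : InitialThetaData F K Fbar E l Pb)

/-! ## §1. The class of row-12 candidates and the emptiness of its scope -/

/-- **ROW 12 `v-divides-l-stratum`, TYPED AS A CLASS**: «any H⋆ whose support is the stratum of bad places `v` with `v ∣ l` or `v ∣ 2`
(deeply-ramified-at-`l` pricing)» — an ARBITRARY per-cell demand `C pp i w` (packet prime `pp`, label `j = i+1 ∈ 𝔽_l^⋇`, place `w ∣ pp` of `K`)
made ONLY at BAD places of the genuine `K`-level datum `pilotDataOfK D K` lying over a prime `p ∣ 2l`. [R-H candidate class, hypothesis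
shape — not a fact] [claim: Mochizuki2012, status: disputed] -/
@[claim "Mochizuki2012" "disputed"]
def OnStratum
    (C : ∀ pp : Nat.Primes, Fin (pilotDataOfK D K).lstar → (thetaIndex (pilotDataOfK D K)).Fibre (.inr pp) → Prop) : Prop :=
  ∀ (pp : Nat.Primes) (i : Fin (pilotDataOfK D K).lstar) (w : (thetaIndex (pilotDataOfK D K)).Fibre (.inr pp)),
    haveI : Fact (pp : ℕ).Prime := ⟨pp.2⟩
    placeOf (pilotDataOfK D K) pp.1 w ∈ (pilotDataOfK D K).S → (pp : ℕ) ∣ 2 * l → C pp i w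

/-- **THE I06⋆ INSTANCE of row 12**: abc-iut-rp-d2's REAL I06⋆ cell «`t_{q,w} ∈ t_{q,w}^{j²} · ℐ_{K_w}`» (`ℐ = (p*)⁻¹·log_p(𝒪^×)`,
[AbsTopIII] Def. 5.4 (iii)) for a q-idele `tq`, demanded ONLY at bad places over primes dividing `2l`. [R-H candidate, hypothesis — not a fact]
[claim: Mochizuki2012, status: disputed] [cite: MochizukiAbsTopIII2015, Def 5.4 (iii) p. 126] -/
@[claim "Mochizuki2012" "disputed"]
def OnStratumI06
    (tq : ∀ (pp : Nat.Primes) (x : (thetaIndex (pilotDataOfK D K)).Fibre (.inr pp)),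
      haveI : Fact (pp : ℕ).Prime := ⟨pp.2⟩; kOf (pilotDataOfK D K) pp.1 x) : Prop :=
  OnStratum D fun pp i w =>
    haveI : Fact (pp : ℕ).Prime := ⟨pp.2⟩
    tq pp w ∈ tq pp w ^ (((i : ℕ) + 1) ^ 2) • logShell (PadicLogOnUnits.ofUnitLog (pp : ℕ) (kOf (pilotDataOfK D K) pp.1 w))

/-- **NO BAD PLACE OF THE GENUINE DATUM LIES OVER A PRIME DIVIDING `2l`**: at `w ∣ p` with `placeOf w ∈ S`, `¬ p ∣ 2l` — [IUTchI] Def. 3.1 (b)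
«odd residue characteristic» and (c) «`l` prime to the elements of `𝕍^bad_mod`» read at `K` (abc-iut-w5-d054
`Cor312Prov.ne_two_and_ne_l_of_placeOf_mem_S_pilotDataOfK`), with `p`, `l` prime. [cite: Mochizuki2012, IUTchI Def. 3.1 (b),(c) pp. 61–62] -/
theorem not_dvd_two_mul_l_of_placeOf_mem_S (pp : Nat.Primes) (w : (thetaIndex (pilotDataOfK D K)).Fibre (.inr pp))
    (hw : haveI : Fact (pp : ℕ).Prime := ⟨pp.2⟩; placeOf (pilotDataOfK D K) pp.1 w ∈ (pilotDataOfK D K).S) :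
    ¬ (pp : ℕ) ∣ 2 * l := by
  obtain ⟨h2, hl⟩ := ne_two_and_ne_l_of_placeOf_mem_S_pilotDataOfK D pp w hw
  intro hdvd
  rcases (Nat.Prime.dvd_mul pp.2).1 hdvd with h | h
  · exact h2 ((Nat.prime_dvd_prime_iff_eq pp.2 Nat.prime_two).1 h)
  · exact hl ((Nat.prime_dvd_prime_iff_eq pp.2 D.l_prime).1 h)

/-- **THE SCOPE OF ROW 12 IS EMPTY at every genuine `K`-level datum**: there is no bad place over a prime dividing `2l`.
[cite: Mochizuki2012, IUTchI Def. 3.1 (b),(c) pp. 61–62] -/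
theorem stratum_empty :
    ¬ ∃ (pp : Nat.Primes) (w : (thetaIndex (pilotDataOfK D K)).Fibre (.inr pp)),
      (haveI : Fact (pp : ℕ).Prime := ⟨pp.2⟩; placeOf (pilotDataOfK D K) pp.1 w ∈ (pilotDataOfK D K).S) ∧ (pp : ℕ) ∣ 2 * l :=
  fun ⟨pp, w, hw, hdvd⟩ => not_dvd_two_mul_l_of_placeOf_mem_S D pp w hw hdvd

/-- **EVERY ROW-12 CANDIDATE HOLDS VACUOUSLY** at every genuine datum, whatever the demand `C`. [folklore] -/
theorem onStratum_holds
    (C : ∀ pp : Nat.Primes, Fin (pilotDataOfK D K).lstar → (thetaIndex (pilotDataOfK D K)).Fibre (.inr pp) → Prop) :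
    OnStratum D C :=
  fun pp _ w hw hdvd => (not_dvd_two_mul_l_of_placeOf_mem_S D pp w hw hdvd).elim

/-- … i.e. a row-12 candidate is the proposition `True` at genuine data (k1: «holds» on every genuine row, with EMPTY scope). [folklore] -/
theorem onStratum_iff_true
    (C : ∀ pp : Nat.Primes, Fin (pilotDataOfK D K).lstar → (thetaIndex (pilotDataOfK D K)).Fibre (.inr pp) → Prop) :
    OnStratum D C ↔ True :=
  iff_true_intro (onStratum_holds D C)

/-- The I06⋆ instance holds vacuously for every q-idele. [claim: Mochizuki2012, status: disputed] -/
theorem onStratumI06_holds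
    (tq : ∀ (pp : Nat.Primes) (x : (thetaIndex (pilotDataOfK D K)).Fibre (.inr pp)),
      haveI : Fact (pp : ℕ).Prime := ⟨pp.2⟩; kOf (pilotDataOfK D K) pp.1 x) :
    OnStratumI06 D tq :=
  onStratum_holds D _

/-- **k2 DOOR = THE TARGET ITSELF**: for every proposition `X` (e.g. the S_H-window clause, the (xi-f) Licence, the typed Statement),
a glue «row-12 candidate → `X`» is a proof of `X` outright. [folklore] -/
theorem imp_iff_of_onStratum
    (C : ∀ pp : Nat.Primes, Fin (pilotDataOfK D K).lstar → (thetaIndex (pilotDataOfK D K)).Fibre (.inr pp) → Prop) (X : Prop) :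
    (OnStratum D C → X) ↔ X :=
  ⟨fun h => h (onStratum_holds D C), fun hX _ => hX⟩

/-- **Dually, a candidate POSITING a priced bad cell on the stratum (`∃` form) is FALSE** at every genuine datum. [folklore] -/
theorem not_exists_supported
    (C : ∀ pp : Nat.Primes, Fin (pilotDataOfK D K).lstar → (thetaIndex (pilotDataOfK D K)).Fibre (.inr pp) → Prop) :
    ¬ ∃ (pp : Nat.Primes) (i : Fin (pilotDataOfK D K).lstar) (w : (thetaIndex (pilotDataOfK D K)).Fibre (.inr pp)),
      (haveI : Fact (pp : ℕ).Prime := ⟨pp.2⟩; placeOf (pilotDataOfK D K) pp.1 w ∈ (pilotDataOfK D K).S) ∧ (pp : ℕ) ∣ 2 * l ∧ C pp i w :=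
  fun ⟨pp, _, w, hw, hdvd, _⟩ => not_dvd_two_mul_l_of_placeOf_mem_S D pp w hw hdvd

/-! ## §2. At the window bed of record `settingPrVolSharp (pilotDataOfK D K) …`: the glue is the Licence itself -/

section WindowBed

variable {logv : PadicLogs K} (hlog : LogvAnalytic logv)
  (M : Type) [Field M] [NumberField M]
  (archPk : ∀ (j : (thetaIndex (pilotDataOfK D K)).Label) (vQ : (thetaIndex (pilotDataOfK D K)).VQ),
    Set ((logShellsDH (pilotDataOfK D K) logv).Packet j vQ))
  (archSub : ∀ (j : (thetaIndex (pilotDataOfK D K)).Label) (v : (thetaIndex (pilotDataOfK D K)).V),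
    Set ((logShellsDH (pilotDataOfK D K) logv).Packet j ((thetaIndex (pilotDataOfK D K)).over v)))
  (Ψ : ℤ → ∀ v : (thetaIndex (pilotDataOfK D K)).V, v ∈ (thetaIndex (pilotDataOfK D K)).Vbad →
    Set ((logShellsDH (pilotDataOfK D K) logv).StarPacket v))
  (act : ℤ → ∀ v : (thetaIndex (pilotDataOfK D K)).V, v ∈ (thetaIndex (pilotDataOfK D K)).Vbad →
    (logShellsDH (pilotDataOfK D K) logv).StarPacket v → Module.End ℚ ((logShellsDH (pilotDataOfK D K) logv).StarPacket v))
  (Mmod : ℤ → ∀ j : (thetaIndex (pilotDataOfK D K)).LabelStar, Set ((logShellsDH (pilotDataOfK D K) logv).GlobalPacket j.1))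
  (region : ℤ → ∀ j : (thetaIndex (pilotDataOfK D K)).LabelStar, FinDivisor M → ∀ vQ : (thetaIndex (pilotDataOfK D K)).VQ,
    Set ((logShellsDH (pilotDataOfK D K) logv).Packet j.1 vQ))
  (n : ℤ) {HT : Type} {LogLink : HT → HT → Type} {IsFull : ∀ {s t : HT}, LogLink s t → Prop}
  (lat : LGPGaussianLogThetaLattice LogLink IsFull)
  {Frd : Type} {IsoF : Frd → Frd → Type} {Ob : Frd → Type} {realify : Frd → Frd} {Strip : Type}
  {IsoS : Strip → Strip → Type} {Mv : ∀ v : (thetaIndex (pilotDataOfK D K)).V, v ∈ (thetaIndex (pilotDataOfK D K)).Vbad → Type}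
  [∀ v h, Monoid (Mv v h)]
  (sig : GlobalLGPFrobenioidSignature (thetaIndex (pilotDataOfK D K)).lstar (thetaIndex (pilotDataOfK D K)).V
    (· ∈ (thetaIndex (pilotDataOfK D K)).Vbad) Frd IsoF Ob realify Strip IsoS Mv)
  (split : SplittingMonoids Mv) {ObΔ : Type} {N : ∀ v : (thetaIndex (pilotDataOfK D K)).V, v ∈ (thetaIndex (pilotDataOfK D K)).Vbad → Type}
  [∀ v h, Monoid (N v h)] (qData : QPilotData ObΔ N)
  (tq : ∀ (pp : Nat.Primes) (x : (thetaIndex (pilotDataOfK D K)).Fibre (.inr pp)),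
    haveI : Fact (pp : ℕ).Prime := ⟨pp.2⟩; kOf (pilotDataOfK D K) pp.1 x)
  (t : ∀ (pp : Nat.Primes) (_ : Fin (pilotDataOfK D K).lstar) (x : (thetaIndex (pilotDataOfK D K)).Fibre (.inr pp)),
    haveI : Fact (pp : ℕ).Prime := ⟨pp.2⟩; kOf (pilotDataOfK D K) pp.1 x)
  (htq0 : ∀ pp x, tq pp x ≠ 0)
  (htq1 : ∀ (pp : Nat.Primes) (x : (thetaIndex (pilotDataOfK D K)).Fibre (.inr pp)),
    haveI : Fact (pp : ℕ).Prime := ⟨pp.2⟩; placeOf (pilotDataOfK D K) pp.1 x ∉ (pilotDataOfK D K).S → ‖tq pp x‖ = 1)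

/-- **AT THE WINDOW BED OF RECORD** (abc-iut-c312-7's `Thm311.Real.settingPrVolSharp (Cor312Prov.pilotDataOfK D K) …`, the bed of the
binder `hSHw` of `Conditional.abc_of_SH_v10K_window`): a glue «row-12 candidate → (xi-f) Licence» is the Licence itself — the candidate supplies
no cell of `CandInternal11GapWindow.licence_of_starOn` (its window has no bad cell). [claim: Mochizuki2012, status: disputed] -/
theorem licence_settingPrVolSharp_imp_iff
    (C : ∀ pp : Nat.Primes, Fin (pilotDataOfK D K).lstar → (thetaIndex (pilotDataOfK D K)).Fibre (.inr pp) → Prop) :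
    (OnStratum D C →
        Thm311ToCor312.Licence
          (settingPrVolSharp (pilotDataOfK D K) hlog M archPk archSub Ψ act Mmod region n lat sig split qData tq t htq0 htq1)) ↔
      Thm311ToCor312.Licence
        (settingPrVolSharp (pilotDataOfK D K) hlog M archPk archSub Ψ act Mmod region n lat sig split qData tq t htq0 htq1) :=
  imp_iff_of_onStratum D C _

/-- The I06⋆ instance at the bed's own q-idele: «I06⋆ on the stratum → Licence» ⟺ Licence. [claim: Mochizuki2012, status: disputed] -/
theorem licence_settingPrVolSharp_imp_iff_I06 :
    (OnStratumI06 D tq →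
        Thm311ToCor312.Licence
          (settingPrVolSharp (pilotDataOfK D K) hlog M archPk archSub Ψ act Mmod region n lat sig split qData tq t htq0 htq1)) ↔
      Thm311ToCor312.Licence
        (settingPrVolSharp (pilotDataOfK D K) hlog M archPk archSub Ψ act Mmod region n lat sig split qData tq t htq0 htq1) :=
  imp_iff_of_onStratum D _ _

end WindowBed

/-! ## §3. The k1 count in the column vocabulary of I06STAR-COLUMNS (`p`, `l`) -/

/-- **k1 SCOPE COUNT, column vocabulary**: among the packets of I06STAR-COLUMNS v1/v2.1 (`p = 7` with `l ∈ {5, 7, 11, 13}` on the strip and the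
admissible `l ≥ 11` of the G-HEX block; DH rows `(p, l) = (11, 13)`, `(67, 7)`) the stratum condition `p ∣ 2l` holds EXACTLY on the `l = 7`
calibration strip (`p = l`, inadmissible by Def. 3.1 (c)) — `7 ∣ 2·7`, and `¬ 7 ∣ 2l` for the other tabulated `l`, `¬ 11 ∣ 26`, `¬ 67 ∣ 14`.
[folklore] -/
theorem dvd_two_mul_iff_of_table :
    (7 ∣ 2 * 7) ∧ ¬ (7 ∣ 2 * 5) ∧ ¬ (7 ∣ 2 * 11) ∧ ¬ (7 ∣ 2 * 13) ∧ ¬ (7 ∣ 2 * 17) ∧ ¬ (7 ∣ 2 * 19) ∧ ¬ (7 ∣ 2 * 23) ∧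
      ¬ (7 ∣ 2 * 29) ∧ ¬ (7 ∣ 2 * 31) ∧ ¬ (7 ∣ 2 * 37) ∧ ¬ (7 ∣ 2 * 41) ∧ ¬ (7 ∣ 2 * 43) ∧ ¬ (7 ∣ 2 * 47) ∧ ¬ (7 ∣ 2 * 53) ∧
      ¬ (7 ∣ 2 * 59) ∧ ¬ (7 ∣ 2 * 61) ∧ ¬ (7 ∣ 2 * 67) ∧ ¬ (7 ∣ 2 * 71) ∧ ¬ (7 ∣ 2 * 73) ∧ ¬ (7 ∣ 2 * 79) ∧ ¬ (7 ∣ 2 * 83) ∧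
      ¬ (7 ∣ 2 * 89) ∧ ¬ (7 ∣ 2 * 97) ∧ ¬ (7 ∣ 2 * 101) ∧ ¬ (11 ∣ 2 * 13) ∧ ¬ (67 ∣ 2 * 7) := by
  decide

/-- For an odd prime `p` and a prime `l`, `p ∣ 2l ↔ p = l`: on genuine rows (Def. 3.1 (c): `p ≠ l` at bad places) the stratum is empty; the
only tabulated packets in scope are those with `p = l`. [folklore] -/
theorem dvd_two_mul_iff_eq {p l : ℕ} (hp : p.Prime) (hp2 : p ≠ 2) (hl : l.Prime) : p ∣ 2 * l ↔ p = l := by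
  constructor
  · intro h
    rcases (Nat.Prime.dvd_mul hp).1 h with h2 | h2
    · exact (hp2 ((Nat.prime_dvd_prime_iff_eq hp Nat.prime_two).1 h2)).elim
    · exact (Nat.prime_dvd_prime_iff_eq hp hl).1 h2
  · rintro rfl
    exact Dvd.intro_left 2 rfl

end Summit.ABC.IUTFork.Repair.RH.VDividesLStratum

end
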